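import Summits.QuantumFields.BalabanUV.Beta.GAN24.DirichletExhaustion

/-!
# `BalabanUV.Beta.GAN24.DirichletExhaustionFamily` — binder row G-an2-4 / (CONV-C), part P2, PART 2: FAMILIES — uniform (5.6)
# + geometric operator step-rate ⟹ (CONV-C) for every Dirichlet inverse family on `Ω ⊆ ℤ^d`, the operator limit `A_∞`,
# `dirichletExhaustion_rate` / `dirichletExhaustion_limit`, non-vacuity (unit b2b-balaban-gan24-p2, gen 1, v1)

HONEST FRAMING (cell contract, verbatim): «discharging `BetaPertH` makes Bałaban's UV stability UNCONDITIONAL — a real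
constructive-QFT result; it is NOT the continuum limit and NOT the Clay problem.»  This is the second half of the P2 leaf
(`GAN24/DirichletExhaustion.lean`, PART 1: the shapes `OpClose` / `OpFamilyRate` / `ConvC`, the constant `rateConst`, the
finite-volume transfer `perturb_rate` and the infinite-volume transfer `limInv_sub_limInv_rate`; see its header for the printed
quotations [Balaban1983RegularityDecay] Sect. 5 p. 594/597, [Balaban1984PropagatorsII] p. 250, [King1986] Lemma 4.5 p. 674 and
for the LOCATED STEP where the printed (5.10) loses the rate).  (CONV-C) is an OPEN analytic input of the β wall and NOT IN
PRINT; this file is [folklore] real analysis on top of PART 1 and of B4's exhaustion (`B4Sect5Exhaustion`, pv23-g7) BY NAME;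
it discharges NOTHING of `BetaPertH`, instantiates no wall binder; NOT continuum, NOT Clay.  «not in print; our proof attempt».

ABSOLUTE RULE (cell, verbatim): «No internally-minted statement may enter as a cited fact. Every hypothesis is either
kernel-proved in this package or a verbatim quotation of a PUBLISHED theorem with page reference. The manuscript(s) under
audit are NOT citable for their own disputed steps — they are the thing under adjudication; programme-internal
(2001/route/tribunal) claims are never citable.»  Every theorem below is kernel-proved from the explicit hypothesis
`OpFamilyRate Ω A γ₀ c₀ δ₀ θ₀ θ` (PART 1 §0) on an abstract operator family; nothing asserts that any kernel IS Bałaban's.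

PLACEMENT: cell topic `Summits/QuantumFields/BalabanUV/Beta/GAN24/` (LEAN PLACEMENT RULE 2026-08-19); imports PART 1 only.

## What this file proves (0 sorry)

§4 FAMILIES: `limInv_step_rate` (`|C_Λ[A_{k+1}] − C_Λ[A_k]| ≤ rateConst·θ₀·θ^k·e^{−δ⋆|x−x′|}`), `limInv_uniform` ((5.7) by
name), **`convC_limInv`** (`ConvC (k ↦ limInv Λ (A k)) (max{c⋆, rateConst·θ₀}) δ⋆ θ` for every `Λ ⊆ Ω`); the operator limit
`opLim A` exists (`tendsto_opLim`, geometric tail `opClose_opLim`: `(θ₀/(1−θ))θ^k`) and inherits (5.6) with the SAME constants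
(`hyp56Z_opLim`); **`dirichletExhaustion_rate`**: `|C_Λ[A_∞] − C_Λ[A_k]|(x,x′) ≤ rateConst·(θ₀/(1−θ))·θ^k·e^{−δ⋆|x−x′|}`;
**`dirichletExhaustion_limit`**: `C_Λ[A_k](x,x′) → C_Λ[A_∞](x,x′)` (the two names of `BETA/GAN24-NAMES.md` §C); §4.4 the limit
kernel is B4's object — decay (5.7), two-sided inverse of `(A_∞)_Λ` with absolutely convergent sums, uniqueness among bounded
kernels (`B4Sect5Exhaustion` §8–§9 BY NAME).
§5 NON-VACUITY: `A_k = (1 + 2^{−k})·I` on `ℤ^d × Fin N` inhabits `OpFamilyRate` with `(γ₀,c₀,δ₀,θ₀,θ) = (1,2,1,½,½)`.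


CONSTANTS: as in PART 1 (`rateConst`, `cStar`, `deltaStar` displayed there); here in addition `convConst = max{c⋆, rateConst·θ₀}`
and the tail factor `θ₀/(1−θ)`.

## Instantiation census for Bałaban's `C^{(k)}(𝟙) = C(C*Δ_kC)⁻¹C*` at `U = 1` (NOT done here; located, with tree names)

(I1) the operator `A_k := C*Δ_kC` on the unit-lattice bond index set (`Δ_k` = the (1.66) form of [Balaban1984PropagatorsI],
`C` = the explicit elimination matrix of B6 p. 250): typed on TORI (`B6Cov2156Torus.deltaPol/elimT`, pv09-g6; `B5Kernel166Decay`,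
b05-g9), NOT typed on `ℤ^d` as a kernel; (I2) `k`-uniform (5.6): lower bound (2.157) (`B6Cov2156Torus.lowerOnConstrainedT_of_represents`,
torus) and decay (`B5Kernel166Decay.kernelDecay166`, torus; B6 p. 250 «same exponential decay as Δ_k»); (I3) the OPERATOR
η-rate of `Δ_k`: IN THE TREE in infinite volume — `T4Rate166StripDirect.latticeKernel_Gsym_rate2` (t4-ne2-p2 gen 4):
`8·C166(d+1)·n⁻²·e^{−κ₁₆₆(d+1)|x|_∞}` on `ℤ^{d+1}` for the (1.66) entry kernels at levels `n = L^k ≤ m`, i.e. `θ = L⁻²`,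
`θ₀ = 8·C166(d+1)·(4 entry kernels × the bond dictionary of `B5Kernel166Decay.inner_eq`)`, `δ₀ := min{δ₀, κ₁₆₆(d+1)}`; on tori
`T4Cov2156Rate.kernelRate166` (θ = L⁻¹) / `T4Rate166StripDirect.ksum_rate2` (θ = L⁻²); (I4) the sandwich: `OpClose` for `Δ_k`
⟹ `OpClose` for `C*Δ_kC` with `ε ↦ ε·(range/size of C)²` (B6 p. 250's sentence, rate version; elementary, owed);
(I5) then `convC_limInv` / `dirichletExhaustion_rate` give (CONV-C) for `(C*Δ_kC)_Λ⁻¹` on EVERY `Λ ⊆ ℤ^d` and the outer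
sandwich `C(·)C*` is again (I4).  The finite-torus analogue of (I1)–(I5) with EXISTENTIAL constants and `θ = L⁻¹` is ALREADY a
theorem of the tree: `T4Cov2156Rate.cov2156_rate_torus_king` (t4-ne2-p2-g3) — this file adds infinite volume / arbitrary
Dirichlet regions, explicit constants, the operator limit and the identification of the limit of the inverses.

NOT CLAIMED: any statement about Bałaban's actual kernels (no instantiation is performed here); the η-rates of `G_k`, `H_k`;
the vertex constituents of (CONV-C); (CONV-Π), (CONV-β), `BetaPertH`, continuum, Clay.  Value = the family / limit half of a
kernel theorem turning B4's qualitative Sect. 5 perturbation statement into a quantitative rate-transfer with displayed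
constants, in infinite volume; NOT summit progress.
-/

namespace Summit.QuantumFields.BalabanUV.Beta.GAN24.DirichletExhaustionFamily

open Finset Real Matrix Filter Topology
open Literature.MathematicalPhysics.QuantumFieldTheory.Balaban1983to89
open B4Sect5Proof (cStar deltaStar delta1 latticeConst latticeConst_nonneg idxSum_le cStar_pos deltaStar_pos
  delta1_pos delta1_le_delta0 bigConst isUnit_of_hyp56 inv_compress_decay inv_sub_inv_eq abs_mul3_apply_le
  sum_sum_le_of_factor exp_split)
open Summit.QuantumFields.BalabanUV.Beta.GAN24.DirichletExhaustion
open B4Sect5Exhaustion (K toMat compress_toMat finInv finInv_of_mem finInv_of_not_mem_left finInv_of_not_mem_right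
  Hyp56Z cut coe_cut_subset limInv tendsto_limInv limInv_abs_le limInv_of_not_mem limInv_symm)

noncomputable section

variable {d N : ℕ}

/-! ## §4  FAMILIES: uniform (5.6) + geometric operator step-rate ⟹ (CONV-C) for every Dirichlet inverse family,
the operator limit `A_∞`, and the convergence of the inverse kernels to `(A_∞)_Λ⁻¹` with an explicit geometric tail -/

section Family

variable {Ω : Set (Fin d → ℤ)} {A : ℕ → K d N → K d N → ℝ} {γ₀ c₀ δ₀ θ₀ θ : ℝ}

/-- **The one-step rate of the inverse kernels**: `|C_Λ[A_{k+1}] − C_Λ[A_k]|(x,x′) ≤ rateConst·θ₀·θ^k·e^{−δ⋆|x−x′|}` for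
every `Λ ⊆ Ω` — the second clause of (CONV-C) with `C₄ = rateConst·θ₀`, `δ₄ = δ⋆`. -/
theorem limInv_step_rate (hγ : 0 < γ₀) (hc : 0 < c₀) (hδ : 0 < δ₀) (hθ₀ : 0 ≤ θ₀) (hθ : 0 ≤ θ)
    (hF : OpFamilyRate Ω A γ₀ c₀ δ₀ θ₀ θ) {Λ : Set (Fin d → ℤ)} (hΛ : Λ ⊆ Ω) (k : ℕ) (p q : K d N) :
    |limInv Λ (A (k + 1)) p q - limInv Λ (A k) p q| ≤
      rateConst d N γ₀ c₀ δ₀ * θ₀ * θ ^ k * Real.exp (-(deltaStar d N γ₀ c₀ δ₀ * dist p.1 q.1)) := by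
  rw [abs_sub_comm, mul_assoc (rateConst d N γ₀ c₀ δ₀)]
  exact limInv_sub_limInv_rate hγ hc hδ (by positivity) (hF.hyp56 k) (hF.hyp56 (k + 1)) (hF.step k) hΛ p q

/-- **The uniform decay of the inverse kernels** (B4 (5.7) BY NAME, `B4Sect5Exhaustion.limInv_abs_le`):
`|C_Λ[A_k]|(x,x′) ≤ c⋆·e^{−δ⋆|x−x′|}` for every `k` and every `Λ ⊆ Ω` — the first clause of (CONV-C). -/
theorem limInv_uniform (hγ : 0 < γ₀) (hc : 0 < c₀) (hδ : 0 < δ₀) (hF : OpFamilyRate Ω A γ₀ c₀ δ₀ θ₀ θ)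
    {Λ : Set (Fin d → ℤ)} (hΛ : Λ ⊆ Ω) (k : ℕ) (p q : K d N) :
    |limInv Λ (A k) p q| ≤ cStar d N γ₀ c₀ δ₀ * Real.exp (-(deltaStar d N γ₀ c₀ δ₀ * dist p.1 q.1)) :=
  limInv_abs_le hγ hc hδ ((hF.hyp56 k).mono hΛ) p q

/-- The (CONV-C) constant `C₄ = max{c⋆, rateConst·θ₀}` serving both clauses. -/
def convConst (d N : ℕ) (γ₀ c₀ δ₀ θ₀ : ℝ) : ℝ := max (cStar d N γ₀ c₀ δ₀) (rateConst d N γ₀ c₀ δ₀ * θ₀)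

/-- **(CONV-C) FOR EVERY DIRICHLET INVERSE FAMILY, EXPLICIT CONSTANTS.**  Under `k`-uniform (5.6) on `Ω ⊆ ℤ^d` and the
operator step-rate `θ₀θ^k` in the `e^{−δ₀|·|}` class, the family `k ↦ C_Λ[A_k] = limInv Λ (A k)` satisfies `ConvC` with
`C₄ = max{c⋆, rateConst·θ₀}`, `δ₄ = δ⋆ = deltaStar(d,N,γ₀,c₀,δ₀)` and the supplier's `θ` — for every `Λ ⊆ Ω`, finite or
infinite.  All constants are displayed functions of `(d, N, γ₀, c₀, δ₀, θ₀)`. -/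
theorem convC_limInv (hγ : 0 < γ₀) (hc : 0 < c₀) (hδ : 0 < δ₀) (hθ₀ : 0 ≤ θ₀) (hθ : 0 ≤ θ)
    (hF : OpFamilyRate Ω A γ₀ c₀ δ₀ θ₀ θ) {Λ : Set (Fin d → ℤ)} (hΛ : Λ ⊆ Ω) :
    ConvC (fun k => limInv Λ (A k)) (convConst d N γ₀ c₀ δ₀ θ₀) (deltaStar d N γ₀ c₀ δ₀) θ := by
  refine ⟨fun k p q => (limInv_uniform hγ hc hδ hF hΛ k p q).trans ?_, fun k p q => ?_⟩
  · exact mul_le_mul_of_nonneg_right (le_max_left _ _) (Real.exp_pos _).le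
  · refine (limInv_step_rate hγ hc hδ hθ₀ hθ hF hΛ k p q).trans ?_
    have h1 : rateConst d N γ₀ c₀ δ₀ * θ₀ ≤ convConst d N γ₀ c₀ δ₀ θ₀ := le_max_right _ _
    have h2 : 0 ≤ θ ^ k * Real.exp (-(deltaStar d N γ₀ c₀ δ₀ * dist p.1 q.1)) := by positivity
    calc rateConst d N γ₀ c₀ δ₀ * θ₀ * θ ^ k * Real.exp (-(deltaStar d N γ₀ c₀ δ₀ * dist p.1 q.1))
        = (rateConst d N γ₀ c₀ δ₀ * θ₀) * (θ ^ k * Real.exp (-(deltaStar d N γ₀ c₀ δ₀ * dist p.1 q.1))) := by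
          ring
      _ ≤ convConst d N γ₀ c₀ δ₀ θ₀ * (θ ^ k * Real.exp (-(deltaStar d N γ₀ c₀ δ₀ * dist p.1 q.1))) :=
          mul_le_mul_of_nonneg_right h1 h2
      _ = convConst d N γ₀ c₀ δ₀ θ₀ * θ ^ k * Real.exp (-(deltaStar d N γ₀ c₀ δ₀ * dist p.1 q.1)) := by
          ring

/-! ### §4.2  The operator limit `A_∞` (it exists: a geometric step-rate makes `k ↦ A_k(x,x′)` Cauchy) -/

/-- The entrywise limit `A_∞(x,x′) = lim_k A_k(x,x′)` of the operator family. -/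
def opLim (A : ℕ → K d N → K d N → ℝ) : K d N → K d N → ℝ := fun p q => limUnder atTop fun k => A k p q

/-- Consecutive operators are `θ₀e^{−δ₀|x−x′|}·θ^k`-close in `dist`. -/
theorem dist_step_le (hF : OpFamilyRate Ω A γ₀ c₀ δ₀ θ₀ θ) {p q : K d N} (hp : p.1 ∈ Ω) (hq : q.1 ∈ Ω)
    (k : ℕ) : dist (A k p q) (A (k + 1) p q) ≤ θ₀ * Real.exp (-(δ₀ * dist p.1 q.1)) * θ ^ k := by
  rw [Real.dist_eq, abs_sub_comm]
  have h := hF.step k p q hp hq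
  linarith [h]

/-- **`A_k(x,x′) → A_∞(x,x′)`** on `Ω × Ω` (`0 ≤ θ < 1`). -/
theorem tendsto_opLim (hF : OpFamilyRate Ω A γ₀ c₀ δ₀ θ₀ θ) (hθ1 : θ < 1) {p q : K d N} (hp : p.1 ∈ Ω)
    (hq : q.1 ∈ Ω) : Tendsto (fun k => A k p q) atTop (𝓝 (opLim A p q)) :=
  tendsto_nhds_limUnder (cauchySeq_tendsto_of_complete
    (cauchySeq_of_le_geometric θ (θ₀ * Real.exp (-(δ₀ * dist p.1 q.1))) hθ1 (dist_step_le hF hp hq)))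

/-- **The geometric tail of the operators**: `|A_∞ − A_k|(x,x′) ≤ (θ₀/(1−θ))·θ^k·e^{−δ₀|x−x′|}` on `Ω × Ω`, i.e.
`OpClose Ω (A k) A_∞ ((θ₀/(1−θ))θ^k) δ₀`. -/
theorem opClose_opLim (hF : OpFamilyRate Ω A γ₀ c₀ δ₀ θ₀ θ) (hθ1 : θ < 1) (k : ℕ) :
    OpClose Ω (A k) (opLim A) (θ₀ / (1 - θ) * θ ^ k) δ₀ := by
  intro p q hp hq
  have h := dist_le_of_le_geometric_of_tendsto θ (θ₀ * Real.exp (-(δ₀ * dist p.1 q.1))) hθ1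
    (dist_step_le hF hp hq) (tendsto_opLim hF hθ1 hp hq) k
  rw [Real.dist_eq, abs_sub_comm] at h
  calc |opLim A p q - A k p q| ≤ θ₀ * Real.exp (-(δ₀ * dist p.1 q.1)) * θ ^ k / (1 - θ) := h
    _ = θ₀ / (1 - θ) * θ ^ k * Real.exp (-(δ₀ * dist p.1 q.1)) := by ring

/-- **`A_∞` inherits (5.6) with the SAME constants** (symmetry and the entry bound pass to the limit; coercivity is a
closed condition on each finite `Λ ⊆ Ω`, where the quadratic form is a finite sum of convergent sequences). -/
theorem hyp56Z_opLim (hF : OpFamilyRate Ω A γ₀ c₀ δ₀ θ₀ θ) (hθ1 : θ < 1) : Hyp56Z Ω (opLim A) γ₀ c₀ δ₀ where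
  symm p q hp hq := by
    have h1 := tendsto_opLim hF hθ1 hp hq
    have h2 := tendsto_opLim hF hθ1 hq hp
    have h3 : (fun k => A k p q) = fun k => A k q p := funext fun k => (hF.hyp56 k).symm p q hp hq
    rw [h3] at h1
    exact tendsto_nhds_unique h1 h2
  coercive Λ hΛ v := by
    classical
    have hlim : Tendsto (fun k => ∑ p, v p * (toMat Λ (A k)).mulVec v p) atTop
        (𝓝 (∑ p, v p * (toMat Λ (opLim A)).mulVec v p)) := by
      refine tendsto_finsetSum _ fun p _ => ?_
      simp only [Matrix.mulVec, dotProduct, toMat]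
      refine Tendsto.const_mul (v p) (tendsto_finsetSum _ fun q _ => ?_)
      exact (tendsto_opLim hF hθ1 (hΛ p.1.2) (hΛ q.1.2)).mul_const (v q)
    exact ge_of_tendsto' hlim fun k => (hF.hyp56 k).coercive Λ hΛ v
  decay p q hp hq :=
    le_of_tendsto' (tendsto_opLim hF hθ1 hp hq).abs fun k => (hF.hyp56 k).decay p q hp hq

/-! ### §4.3  The Dirichlet exhaustion limit with its explicit rate: `C_Λ[A_k] → C_Λ[A_∞]` -/

/-- **`dirichletExhaustion_rate` — THE RATE THEOREM** (name adopted from the cell sheet `BETA/GAN24-NAMES.md` §C).  Under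
`k`-uniform (5.6) on `Ω ⊆ ℤ^d` and the operator step-rate `θ₀θ^k` (`0 ≤ θ < 1`), for every `Λ ⊆ Ω` (finite or infinite),
every `k` and all `x, x′`:
`|C_Λ[A_∞](x,x′) − C_Λ[A_k](x,x′)| ≤ rateConst·(θ₀/(1−θ))·θ^k·e^{−δ⋆|x−x′|}`,
where `C_Λ[·] = B4Sect5Exhaustion.limInv Λ ·` is B4's Dirichlet-exhaustion inverse kernel and `A_∞ = opLim A`.  Constants:
`rateConst = (2/γ₀)²(N·K_d(δ₁/2))²`, `δ⋆ = δ₁/4`, `δ₁ = min{δ₀/4, γ₀/(2M₀+1)}`, `M₀ = c₀(4/δ₀)N·K_d(δ₀/2)`,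
`K_d(a) = (2/(1−e^{−a/d}))^d` — explicit in `(d, N, γ₀, c₀, δ₀)`; `(θ₀, θ)` are the supplier's. -/
theorem dirichletExhaustion_rate (hγ : 0 < γ₀) (hc : 0 < c₀) (hδ : 0 < δ₀) (hθ₀ : 0 ≤ θ₀) (hθ : 0 ≤ θ)
    (hθ1 : θ < 1) (hF : OpFamilyRate Ω A γ₀ c₀ δ₀ θ₀ θ) {Λ : Set (Fin d → ℤ)} (hΛ : Λ ⊆ Ω) (k : ℕ)
    (p q : K d N) :
    |limInv Λ (opLim A) p q - limInv Λ (A k) p q| ≤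
      rateConst d N γ₀ c₀ δ₀ * (θ₀ / (1 - θ) * θ ^ k) *
        Real.exp (-(deltaStar d N γ₀ c₀ δ₀ * dist p.1 q.1)) := by
  rw [abs_sub_comm]
  have hε : 0 ≤ θ₀ / (1 - θ) * θ ^ k := by
    have : 0 < 1 - θ := by linarith
    positivity
  exact limInv_sub_limInv_rate hγ hc hδ hε (hF.hyp56 k) (hyp56Z_opLim hF hθ1) (opClose_opLim hF hθ1 k) hΛ p q

/-- `c·(a·θ^k)·e → 0` for `0 ≤ θ < 1`. -/
theorem tendsto_const_mul_pow {c a e θ : ℝ} (hθ : 0 ≤ θ) (hθ1 : θ < 1) :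
    Tendsto (fun k : ℕ => c * (a * θ ^ k) * e) atTop (𝓝 0) := by
  have h := (tendsto_pow_atTop_nhds_zero_of_lt_one hθ hθ1).const_mul a
  have h2 := (h.const_mul c).mul_const e
  simpa using h2

/-- **`dirichletExhaustion_limit` — THE LIMIT THEOREM** (name adopted from `BETA/GAN24-NAMES.md` §C): the Dirichlet inverse
kernels of the family converge entrywise, for every `Λ ⊆ Ω`, to the Dirichlet inverse kernel of the limit operator:
`C_Λ[A_k](x,x′) → C_Λ[A_∞](x,x′)` — «the limit of the inverses is the inverse of the limit», both built by B4's exhaustion. -/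
theorem dirichletExhaustion_limit (hγ : 0 < γ₀) (hc : 0 < c₀) (hδ : 0 < δ₀) (hθ₀ : 0 ≤ θ₀) (hθ : 0 ≤ θ)
    (hθ1 : θ < 1) (hF : OpFamilyRate Ω A γ₀ c₀ δ₀ θ₀ θ) {Λ : Set (Fin d → ℤ)} (hΛ : Λ ⊆ Ω) (p q : K d N) :
    Tendsto (fun k => limInv Λ (A k) p q) atTop (𝓝 (limInv Λ (opLim A) p q)) := by
  have hb := tendsto_const_mul_pow (c := rateConst d N γ₀ c₀ δ₀) (a := θ₀ / (1 - θ))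
    (e := Real.exp (-(deltaStar d N γ₀ c₀ δ₀ * dist p.1 q.1))) hθ hθ1
  refine tendsto_sub_nhds_zero_iff.1 (squeeze_zero_norm (fun k => ?_) hb)
  rw [Real.norm_eq_abs, abs_sub_comm]
  exact dirichletExhaustion_rate hγ hc hδ hθ₀ hθ hθ1 hF hΛ k p q

/-! ### §4.4  The limit kernel is B4's object: decay (5.7), two-sided inverse of `(A_∞)_Λ`, uniqueness — BY NAME -/

/-- The limit inverse kernel decays with the same pair `(c⋆, δ⋆)` (B4 (5.7) for `A_∞`, `B4Sect5Exhaustion.limInv_abs_le`). -/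
theorem limInv_opLim_abs_le (hγ : 0 < γ₀) (hc : 0 < c₀) (hδ : 0 < δ₀) (hθ1 : θ < 1)
    (hF : OpFamilyRate Ω A γ₀ c₀ δ₀ θ₀ θ) {Λ : Set (Fin d → ℤ)} (hΛ : Λ ⊆ Ω) (p q : K d N) :
    |limInv Λ (opLim A) p q| ≤ cStar d N γ₀ c₀ δ₀ * Real.exp (-(deltaStar d N γ₀ c₀ δ₀ * dist p.1 q.1)) :=
  limInv_abs_le hγ hc hδ ((hyp56Z_opLim hF hθ1).mono hΛ) p q

/-- The limit inverse kernel IS the inverse of `(A_∞)_Λ = ΛA_∞Λ`: `Σ_y A_∞(x,y)·C_Λ[A_∞](y,x′) = δ_{xx′}` for `x, x′ ∈ Λ`,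
absolutely convergent (B4's Sect. 5 Theorem for arbitrary `Ω`, `B4Sect5Exhaustion.tsum_mul_limInv`, BY NAME). -/
theorem tsum_opLim_mul_limInv (hγ : 0 < γ₀) (hc : 0 < c₀) (hδ : 0 < δ₀) (hθ1 : θ < 1)
    (hF : OpFamilyRate Ω A γ₀ c₀ δ₀ θ₀ θ) {Λ : Set (Fin d → ℤ)} (hΛ : Λ ⊆ Ω) {p r : K d N} (hp : p.1 ∈ Λ)
    (hr : r.1 ∈ Λ) : ∑' q, opLim A p q * limInv Λ (opLim A) q r = if p = r then 1 else 0 :=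
  B4Sect5Exhaustion.tsum_mul_limInv hγ hc hδ ((hyp56Z_opLim hF hθ1).mono hΛ) hp hr

/-- … and from the left: `Σ_y C_Λ[A_∞](x,y)·A_∞(y,x′) = δ_{xx′}` (`B4Sect5Exhaustion.tsum_limInv_mul`). -/
theorem tsum_limInv_mul_opLim (hγ : 0 < γ₀) (hc : 0 < c₀) (hδ : 0 < δ₀) (hθ1 : θ < 1)
    (hF : OpFamilyRate Ω A γ₀ c₀ δ₀ θ₀ θ) {Λ : Set (Fin d → ℤ)} (hΛ : Λ ⊆ Ω) {p r : K d N} (hp : p.1 ∈ Λ)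
    (hr : r.1 ∈ Λ) : ∑' q, limInv Λ (opLim A) p q * opLim A q r = if p = r then 1 else 0 :=
  B4Sect5Exhaustion.tsum_limInv_mul hγ hc hδ ((hyp56Z_opLim hF hθ1).mono hΛ) hp hr

/-- UNIQUENESS of the limit object among bounded kernels: any entrywise-bounded left inverse kernel of `(A_∞)_Λ` vanishing
off `Λ` in its second index IS `C_Λ[A_∞]` on `Λ × Λ` (`B4Sect5Exhaustion.eq_limInv_of_left_inverse`) — so the `k → ∞` limit of
the inverse kernels is forced, not a choice of exhaustion. -/
theorem eq_limInv_opLim_of_left_inverse (hγ : 0 < γ₀) (hc : 0 < c₀) (hδ : 0 < δ₀) (hθ1 : θ < 1)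
    (hF : OpFamilyRate Ω A γ₀ c₀ δ₀ θ₀ θ) {Λ : Set (Fin d → ℤ)} (hΛ : Λ ⊆ Ω)
    {D : K d N → K d N → ℝ} {M : ℝ} (hDM : ∀ p q, |D p q| ≤ M) (hD0 : ∀ p q : K d N, q.1 ∉ Λ → D p q = 0)
    (hDA : ∀ p r : K d N, p.1 ∈ Λ → r.1 ∈ Λ → ∑' q, D p q * opLim A q r = if p = r then 1 else 0)
    {p s : K d N} (hp : p.1 ∈ Λ) (hs : s.1 ∈ Λ) : D p s = limInv Λ (opLim A) p s :=
  B4Sect5Exhaustion.eq_limInv_of_left_inverse hγ hc hδ ((hyp56Z_opLim hF hθ1).mono hΛ) hDM hD0 hDA hp hs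

end Family

/-! ## §5  NON-VACUITY: an operator family on `Ω = ℤ^d` satisfying `OpFamilyRate` with a genuine rate (`θ₀ = θ = 1/2`) -/

section Witness

/-- The witness family `A_k = (1 + 2^{−k})·I` on `ℤ^d × Fin N`. -/
def witnessA (d N : ℕ) (k : ℕ) : K d N → K d N → ℝ :=
  fun p q => if p = q then 1 + (1 / 2 : ℝ) ^ k else 0

/-- `(1 + 2^{−k})·I` satisfies (5.6) on `Ω = ℤ^d` with `γ₀ = 1`, `c₀ = 2`, `δ₀ = 1`, for every `k`. -/
theorem hyp56Z_witnessA (d N k : ℕ) : Hyp56Z (Set.univ : Set (Fin d → ℤ)) (witnessA d N k) 1 2 1 := by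
  classical
  have hpow0 : 0 ≤ (1 / 2 : ℝ) ^ k := by positivity
  have hpow1 : (1 / 2 : ℝ) ^ k ≤ 1 := pow_le_one₀ (by norm_num) (by norm_num)
  refine ⟨fun p q _ _ => ?_, fun Λ _ v => ?_, fun p q _ _ => ?_⟩
  · by_cases h : p = q
    · subst h; rfl
    · simp only [witnessA, if_neg h, if_neg (Ne.symm h)]
  · have hmv : ∀ p : B4.Idx Λ N, (toMat Λ (witnessA d N k)).mulVec v p = (1 + (1 / 2 : ℝ) ^ k) * v p := by
      intro p
      have hone : toMat Λ (witnessA d N k) = (1 + (1 / 2 : ℝ) ^ k) • (1 : Matrix (B4.Idx Λ N) (B4.Idx Λ N) ℝ) := by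
        ext a b
        simp only [toMat, witnessA, Matrix.smul_apply, Matrix.one_apply, smul_eq_mul, mul_ite, mul_one, mul_zero]
        by_cases hab : a = b
        · subst hab; simp
        · have : ((a.1 : Fin d → ℤ), a.2) ≠ ((b.1 : Fin d → ℤ), b.2) := by
            intro h
            apply hab
            have h1 : (a.1 : Fin d → ℤ) = (b.1 : Fin d → ℤ) := (Prod.ext_iff.1 h).1
            have h2 : a.2 = b.2 := (Prod.ext_iff.1 h).2
            exact Prod.ext (Subtype.ext h1) h2
          rw [if_neg this, if_neg hab]
      rw [hone, Matrix.smul_mulVec, Matrix.one_mulVec, Pi.smul_apply, smul_eq_mul]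
    simp_rw [hmv]
    have : ∑ p, v p * ((1 + (1 / 2 : ℝ) ^ k) * v p) = (1 + (1 / 2 : ℝ) ^ k) * ∑ p, v p ^ 2 := by
      rw [Finset.mul_sum]; exact Finset.sum_congr rfl fun p _ => by ring
    rw [this]
    have hs : 0 ≤ ∑ p, v p ^ 2 := Finset.sum_nonneg fun p _ => sq_nonneg _
    nlinarith
  · by_cases h : p = q
    · subst h
      simp only [witnessA, if_true, dist_self, mul_zero, neg_zero, Real.exp_zero, mul_one]
      rw [abs_of_nonneg (by positivity)]
      linarith
    · simp only [witnessA, if_neg h, abs_zero]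
      positivity

/-- The witness has the operator step-rate `θ₀ = θ = 1/2`: `|A_{k+1} − A_k| = 2^{−(k+1)}·I ≤ (1/2)(1/2)^k e^{−0}`. -/
theorem opClose_witnessA (d N k : ℕ) :
    OpClose (Set.univ : Set (Fin d → ℤ)) (witnessA d N k) (witnessA d N (k + 1)) (1 / 2 * (1 / 2 : ℝ) ^ k) 1 := by
  intro p q _ _
  by_cases h : p = q
  · subst h
    simp only [witnessA, if_true, dist_self, mul_zero, neg_zero, Real.exp_zero, mul_one, pow_succ]
    rw [show (1 : ℝ) + (1 / 2) ^ k * (1 / 2) - (1 + (1 / 2) ^ k) = -((1 / 2) * (1 / 2) ^ k) by ring, abs_neg,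
      abs_of_nonneg (by positivity)]
  · simp only [witnessA, if_neg h, sub_zero, abs_zero]
    positivity

/-- **Non-vacuity**: `OpFamilyRate ℤ^d (witnessA d N) 1 2 1 (1/2) (1/2)` — the hypothesis class of §4 is inhabited with
`θ < 1`, `θ₀ > 0`, so every theorem of §4 has content. -/
theorem opFamilyRate_witnessA (d N : ℕ) :
    OpFamilyRate (Set.univ : Set (Fin d → ℤ)) (witnessA d N) 1 2 1 (1 / 2) (1 / 2) :=
  ⟨hyp56Z_witnessA d N, opClose_witnessA d N⟩

/-- The hypothesis class of the headline theorems is inhabited (existential packaging for the cell's vacuity audits). -/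
theorem opFamilyRate_nonvacuous (d N : ℕ) :
    ∃ (A : ℕ → K d N → K d N → ℝ) (γ₀ c₀ δ₀ θ₀ θ : ℝ), 0 < γ₀ ∧ 0 < c₀ ∧ 0 < δ₀ ∧ 0 < θ₀ ∧ 0 < θ ∧ θ < 1 ∧
      OpFamilyRate (Set.univ : Set (Fin d → ℤ)) A γ₀ c₀ δ₀ θ₀ θ :=
  ⟨witnessA d N, 1, 2, 1, 1 / 2, 1 / 2, by norm_num, by norm_num, by norm_num, by norm_num, by norm_num,
    by norm_num, opFamilyRate_witnessA d N⟩

end Witness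


end

end Summit.QuantumFields.BalabanUV.Beta.GAN24.DirichletExhaustionFamily
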